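import Summits.KontsevichZagierPeriods.KontsevichZagierPeriods.Theorems.HurwitzMicroSectorsNormalFormPrincipleLevelOne
import Summits.KontsevichZagierPeriods.KontsevichZagierPeriods.Theorems.HurwitzMicroSectorsNormalFormPrincipleSlabASubPtK20
import Summits.KontsevichZagierPeriods.KontsevichZagierPeriods.Theorems.HurwitzMicroSectorsNormalFormPrincipleAlgCarriers
import Summits.KontsevichZagierPeriods.KontsevichZagierPeriods.Theorems.HurwitzMicroSectorsNormalFormPrincipleM2FiveZetaTwo
import Summits.KontsevichZagierPeriods.KontsevichZagierPeriods.Theorems.HurwitzMicroSectorsNormalFormPrincipleLevelKPowerSubstitution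

/-!
# `NormalFormPrinciple` (stmt-KontsevichZagierPeriods-3869), line `SketchIdeator1` — leaf `stub_boxRigidity`:
# all weights, level `K`, totally off resonance: the power substitution `xᵢ ↦ xᵢ^{mᵢ}` in dimension `w` (rule 2)

Pure proof file (`--supports` the crux). Registered sub-goal `power_substitutionN` of the layer
"Conjecture 1 for the weight-`w` boxes `[(0,1)^w, c (∏ᵢ xᵢ^{eᵢ})/(1 − ∏ᵢ xᵢ^{kᵢ})]` totally off
resonance" (lead file `…WeightN`), the dimension-generic version of `LevelK.power_substitution`
(`w = 2`) and `Weight3.power_substitution3` (`w = 3`): the box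
`[(0,1)^w, c (∏ᵢ xᵢ^{eᵢ})/(1 − ∏ᵢ xᵢ^{kᵢ})]` is the push-forward, by ONE change of variables, of
`[(0,1)^w, c (∏ᵢ mᵢ) (∏ᵢ Xᵢ^{(eᵢ+1)mᵢ−1})/(1 − ∏ᵢ Xᵢ^{kᵢmᵢ})]` (`mᵢ ≥ 1`).

The chart `Φ(X)ᵢ = Xᵢ^{mᵢ}` is the coordinatewise power chart of the open unit box onto itself
(`LevelK.lk_exists_coordPowChart`, stated in every dimension: `ℚ`-semialgebraic, differentiable
with `|det DΦ| = ∏ᵢ mᵢ Xᵢ^{mᵢ−1}`, injective on the box and onto it). The pull-back identity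
`c (∏ᵢ (Xᵢ^{mᵢ})^{eᵢ})/(1 − ∏ᵢ (Xᵢ^{mᵢ})^{kᵢ}) · ∏ᵢ mᵢ Xᵢ^{mᵢ−1}
  = c (∏ᵢ mᵢ) (∏ᵢ Xᵢ^{(eᵢ+1)mᵢ−1})/(1 − ∏ᵢ Xᵢ^{kᵢmᵢ})`
holds identically (`wn_pow_pullback`: `Finset.prod_mul_distrib`, `pow_mul`, `pow_add`,
`Nat.cast_prod` and the natural-number identity `(e+1)m − 1 = e m + (m − 1)` for `m ≥ 1`). Hence
`[N'] − [N] ∈ KZ.changeOfVariablesRel ⊆ KZ.relations` (source = the pull-back `N'`, image = `N`),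
and `[N] − [N']` is its negative. Rule (2) asks for the integrand identity on the domain only, so
the `EqOn` hypotheses suffice; the algebraicity of `c` and the positivity of the `kᵢ` are not
used (both representations being given). The case `w = 0` is allowed (all products are empty).

References: M. Kontsevich, D. Zagier, *Periods* (2001), §1.2 rule (2). No new definitions.
-/

noncomputable section

open MeasureTheory Set
open Literature.NumberTheory.Transcendental Literature.NumberTheory.Transcendental.KZ
open Literature.ModelTheory.ExponentialFields (IsSemialgebraic)

namespace Summit.KontsevichZagierPeriods.HurwitzMicroSectors.NormalFormPrinciple.PiBox.WeightN

/-- **The monomial part of the pull-back** of the power chart `Φ(X)ᵢ = Xᵢ^{mᵢ}`, `mᵢ ≥ 1`: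
`∏ᵢ Xᵢ^{(eᵢ+1)mᵢ−1} = (∏ᵢ (Xᵢ^{mᵢ})^{eᵢ}) · ∏ᵢ Xᵢ^{mᵢ−1}`, identically in `X`
(`(e+1)m − 1 = e m + (m − 1)` is a genuine natural number as `m ≥ 1`). [folklore] -/
theorem wn_prod_pow_pullback {w : ℕ} (e : Fin w → ℕ) {m : Fin w → ℕ} (hm : ∀ i, 0 < m i)
    (x : Fin w → ℝ) :
    ∏ i, x i ^ ((e i + 1) * m i - 1) = (∏ i, (x i ^ m i) ^ e i) * ∏ i, x i ^ (m i - 1) := by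
  rw [← Finset.prod_mul_distrib]
  refine Finset.prod_congr rfl fun i _ => ?_
  have ei : (e i + 1) * m i - 1 = m i * e i + (m i - 1) := by
    have := hm i
    rw [add_one_mul, mul_comm]
    omega
  rw [ei, pow_add, pow_mul]

/-- **The level part of the pull-back** of the power chart `Φ(X)ᵢ = Xᵢ^{mᵢ}`:
`∏ᵢ Xᵢ^{kᵢmᵢ} = ∏ᵢ (Xᵢ^{mᵢ})^{kᵢ}`, identically in `X`. [folklore] -/
theorem wn_prod_pow_level {w : ℕ} (k m : Fin w → ℕ) (x : Fin w → ℝ) :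
    ∏ i, x i ^ (k i * m i) = ∏ i, (x i ^ m i) ^ k i :=
  Finset.prod_congr rfl fun i _ => by rw [mul_comm, pow_mul]

/-- **The pull-back identity** of the power chart `Φ(X)ᵢ = Xᵢ^{mᵢ}` (Jacobian
`∏ᵢ mᵢ Xᵢ^{mᵢ−1}` included), `mᵢ ≥ 1`:
`c (∏ᵢ mᵢ) (∏ᵢ Xᵢ^{(eᵢ+1)mᵢ−1})/(1 − ∏ᵢ Xᵢ^{kᵢmᵢ})
  = c (∏ᵢ (Xᵢ^{mᵢ})^{eᵢ})/(1 − ∏ᵢ (Xᵢ^{mᵢ})^{kᵢ}) · ∏ᵢ mᵢ Xᵢ^{mᵢ−1}`,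
identically in `X`. [folklore] -/
theorem wn_pow_pullback {w : ℕ} (c : ℝ) (e k : Fin w → ℕ) {m : Fin w → ℕ} (hm : ∀ i, 0 < m i)
    (x : Fin w → ℝ) :
    c * ((∏ i, m i : ℕ) : ℝ) * (∏ i, x i ^ ((e i + 1) * m i - 1)) /
        (1 - ∏ i, x i ^ (k i * m i)) =
      c * (∏ i, (x i ^ m i) ^ e i) / (1 - ∏ i, (x i ^ m i) ^ k i) *
        ∏ i, (m i : ℝ) * x i ^ (m i - 1) := by
  rw [wn_prod_pow_pullback e hm x, wn_prod_pow_level k m x, Finset.prod_mul_distrib,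
    Nat.cast_prod]
  ring

/-- **Stub N1 (the power substitution `xᵢ ↦ xᵢ^{mᵢ}` in dimension `w`, rule 2):**
`[(0,1)^w, c (∏ᵢ xᵢ^{eᵢ})/(1 − ∏ᵢ xᵢ^{kᵢ})]` is the push-forward of
`[(0,1)^w, c (∏ᵢ mᵢ) (∏ᵢ Xᵢ^{(eᵢ+1)mᵢ−1})/(1 − ∏ᵢ Xᵢ^{kᵢmᵢ})]`. One raw change-of-variables
move `KZ.changeOfVariablesRel` with source the pull-back `N'`, chart `Φ(X)ᵢ = Xᵢ^{mᵢ}`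
(`LevelK.lk_exists_coordPowChart` with exponent vector `m`) and image `N`: the identity
`N'.integrand = (N.integrand ∘ Φ) · |det DΦ|` on the box is `wn_pow_pullback`; then
`[N] − [N'] = −([N'] − [N])`. (The hypotheses that `c` is algebraic and `kᵢ ≥ 1` are not needed:
both representations are given; `w = 0` is allowed.) [cite: KontsevichZagier2001, §1.2 rule (2)] -/
theorem power_substitutionN (w : ℕ) (m k e : Fin w → ℕ) (hm : ∀ i, 0 < m i) (hk : ∀ i, 0 < k i)
    (c : ℝ) (hc : IsAlgebraic ℚ c) (N N' : IntegralRep w)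
    (hNd : N.domain = {x | ∀ i, x i ∈ Set.Ioo (0:ℝ) 1})
    (hNi : EqOn N.integrand (fun x => c * (∏ i, x i ^ (e i)) / (1 - ∏ i, x i ^ (k i))) N.domain)
    (hN'd : N'.domain = {x | ∀ i, x i ∈ Set.Ioo (0:ℝ) 1})
    (hN'i : EqOn N'.integrand (fun x => c * ((∏ i, m i : ℕ) : ℝ) *
      (∏ i, x i ^ ((e i + 1) * m i - 1)) / (1 - ∏ i, x i ^ (k i * m i))) N'.domain) :
    of N - of N' ∈ relations := by
  -- `hc`, `hk` are not needed (both representations are given); record and drop them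
  have _ : IsAlgebraic ℚ c := hc
  have _ : ∀ i, 0 < k i := hk
  clear hc hk
  obtain ⟨Φ, Φ', hΦ, hsa, hderiv, hinj, himage, hdet⟩ :=
    LevelK.lk_exists_coordPowChart m fun i => (hm i).ne'
  have himage' : N.domain = Φ '' N'.domain := by rw [hN'd, himage, hNd]
  have hsa' : IsSemialgebraicMapOn ℚ N'.domain Φ := by rw [hN'd]; exact hsa
  have hinj' : InjOn Φ N'.domain := by rw [hN'd]; exact hinj
  -- the raw rule-(2) witness: source the pull-back `N'`, image `N`
  have h : of N' - of N ∈ relations := by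
    refine changeOfVariablesRel_subset_relations
      ⟨w, N', N, Φ, Φ', hsa', fun x _ => (hderiv x).hasFDerivWithinAt, hinj', himage',
        fun x hx => ?_, rfl⟩
    -- the pull-back identity on `N'.domain`, Jacobian `|det DΦ| = ∏ᵢ mᵢ xᵢ^{mᵢ-1}`
    have hΦx : Φ x ∈ N.domain := himage' ▸ mem_image_of_mem _ hx
    have hx' : x ∈ {x : Fin w → ℝ | ∀ i, x i ∈ Set.Ioo (0:ℝ) 1} := hN'd ▸ hx
    rw [hN'i hx, hNi hΦx, hdet x hx']
    simp only [hΦ]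
    exact wn_pow_pullback c e k hm x
  simpa only [neg_sub] using relations.neg_mem h

end Summit.KontsevichZagierPeriods.HurwitzMicroSectors.NormalFormPrinciple.PiBox.WeightN
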